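import Summits.QuantumFields.YangMills.Theorems.ForcedResponseSkewnessFemtoEngineCoarsePin
import Summits.QuantumFields.YangMills.Theorems.ForcedResponseSkewnessFemtoEngineInterface
import HarnessLib

/-!
# Route `ForcedResponseSkewness`: the route certificate in ENGINE-NATIVE form (lead `ym-line-frs-p1` g7, 2026-08-28)

Helper file (`--supports stmt-QuantumFields-26871`, also serves 24275).  One-line compositions of the landed certificate
`FemtoEngine.nt_of_femtoEngine : FemtoEngineSigR → FloorWithScalingLimits → NT` (g6, `…FemtoEngineInterface.lean`) with g7's
`FemtoEngine.femtoEngineSigR_of_fine : FemtoEngineFineSigR → FemtoEngineSigR` (`…FemtoEngineCoarsePin.lean`): the route's whole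
physics debt outside the residual, in the shape an engine delivers — for every compact simple `G` and lattice representation `r`,
ONE unit map `u → 0⁺` carrying the three femto laws `FemtoEngineAt G r u` (E0′ `FBL6Osc`, E-sym `CentredOscLaw`, E-log `CentredFemtoLog`:
centred femto cubes along `u`, the centre, arbitrary exteriors) together with the fine pinning `FloorPinsFine G r u` (no clause-(i)
floor survives in a unit drifting finer than `u`) — implies both cruxes and, with the declared residual `FloorWithScalingLimits`, the leaf `NT`.

* `responseLocalisation_of_femtoEngineFine : FemtoEngineFineSigR → ResponseLocalisation`
* `runningCouplingCeiling_of_femtoEngineFine : FemtoEngineFineSigR → RunningCouplingCeiling`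
* `nt_of_femtoEngineFine : FemtoEngineFineSigR → FloorWithScalingLimits → BalabanLadder.NT`

HONEST LABEL: kernel-checked compositions on a conditional rung line (leaf R2a `BalabanLadder.NT`, not the summit Statement); the audit
classifies them `proof.conditional`, as it must: `FemtoEngineAt` (Bałaban-class engine, not in print), `FloorPinsFine` (IR-light), the residual
24873, the cruxes 26871/24275, `NT` and the Yang–Mills mass gap are NOT proved.
-/

set_option autoImplicit false

noncomputable section

namespace Summit.QuantumFields.YangMills.Cruxes.ResponseLocalisation.FemtoEngine

open Summit.QuantumFields.YangMills.Cruxes.ResponseLocalisation.Birth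
open Summit.QuantumFields.YangMills.Theses.ForcedResponseSkewness

/-- **Deciding crux from the engine-native interface**: `FemtoEngineFineSigR → ResponseLocalisation`. [folklore] -/
theorem responseLocalisation_of_femtoEngineFine (hF : FemtoEngineFineSigR) : ResponseLocalisation :=
  responseLocalisation_of_femtoEngine (femtoEngineSigR_of_fine hF)

/-- **Crux 24275 from the engine-native interface**: `FemtoEngineFineSigR → RunningCouplingCeiling`. [folklore] -/
theorem runningCouplingCeiling_of_femtoEngineFine (hF : FemtoEngineFineSigR) : RunningCouplingCeiling :=
  runningCouplingCeiling_of_femtoEngine (femtoEngineSigR_of_fine hF)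

/-- **The route certificate in engine-native form**: the three femto laws in ONE unit per `(G, r)` with fine pinning, plus the
declared residual, give the leaf `NT` (through `Assembly`/`closes`).  Conditional; nothing of the hypotheses is proved. [folklore] -/
theorem nt_of_femtoEngineFine (hF : FemtoEngineFineSigR) (hRes : FloorWithScalingLimits) :
    Summit.QuantumFields.YangMills.Theses.BalabanLadder.NT :=
  nt_of_femtoEngine (femtoEngineSigR_of_fine hF) hRes

end Summit.QuantumFields.YangMills.Cruxes.ResponseLocalisation.FemtoEngine

end
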